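import Mathlib
import Summits.ValiantsHypothesis.ValiantsHypothesis.Theses.FeketeSOS

/-!
# `FeketeBoundedFanin` — negative lemmas: the Legendre SIGNS and the PRIMALITY of `p` are load-bearing

Crux `stmt-ValiantsHypothesis-3998` = `Summit.ValiantsHypothesis.ValiantsHypothesis.Theses.FeketeSOS.FeketeBoundedFanin`
(route FeketeSOS, rank 5).  Standing disprover (cdisprove gen 1, cycle 1), `Cruxes/FeketeBoundedFanin/Disproof.lean` §A, §A2.

* §A "FeketeBoundedFaninWithoutLegendre" (spelled out inline in the theorem; this file introduces NO definitions, cf. the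
  named `def` in `Cruxes/FeketeBoundedFanin/Disproof.lean`) is the crux with the arithmetic of `χ_p` deleted: `(m|p)` is replaced by the
  constant sign `1` for `m ≠ 0` (and `0` at `m = 0`, as `(0|p) = 0`) — the all-ones target `U_p = ∑_{1 ≤ m < p} X^m` on the
  SAME support `[1, p−1]` with the SAME `|coeff| = 1`; primes, degree cap `p²`, quantifier shape and support-sum measure
  verbatim.  `allOnes_eq_prod_add`: `U_p = A_k·B_k + C_{k,r}` (`A_k = X ∑_{a<k} X^a`, `B_k = ∑_{b<k} X^{kb}`,
  `C_{k,r} = X^{k²+1} ∑_{j<r} X^j`, `k² ≤ p−1`, `r = p−1−k²`); `feketeBoundedFanin_false_without_legendre`: FALSE at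
  `s₀ = 4` (`k = ⌊√(p−1)⌋`, `U_p = ¼(A+B)² − ¼(A−B)² + ¼(C+1)² − ¼(C−1)²`, support-sum `≤ 8k+2 < 11√p ≤ p^{1/2+δ}` for
  `p ≥ 11^{1/δ}`).  MORAL: everything `U_p` shares — unimodular coefficients, support `[1,p−1]`, the counting layer
  (`TrivialSupportBound`, `ThinSquaresCovering`), the degree cap — cannot prove the crux; the sign pattern must enter.
* §A2 "FeketeBoundedFaninJacobi" (inline; named `def` in the Disproof file) is the crux with primality weakened to oddness (Jacobi symbol; on primes it IS the crux,
  `jacobiSym.legendreSym.to_jacobiSym`).  `jacobi_sq_sum_eq`: `∑_{m<qN} J(m|q²) X^m = (∑_{1≤a<q} X^a)·∑_{b<N} X^{qb}`;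
  `feketeBoundedFanin_false_with_jacobi`: FALSE at `s₀ = 2` (`n = q²`, support-sum `≤ 4q−2 < 5q ≤ n^{1/2+δ}`).  MORAL:
  the proof must use that `p` is prime (squarefree) — periodicity of `χ` modulo a proper divisor is exactly the digit
  structure that makes squares cheap (consistent with the sibling crux's char-`p` lever `F_p ≡ ±X A_h(X)(X−1)^{(p−1)/2}`).
[folklore]
-/

namespace Summit.ValiantsHypothesis.ValiantsHypothesis.Theorems.FeketeBoundedFanin.Negative

open Polynomial Finset
open scoped BigOperators

noncomputable section

/-! Local notations (no definitions are introduced by this file; every statement is over Mathlib terms and the crux's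
literal right-hand side). -/

/-- `𝔸⟮k⟯ = X · ∑_{a<k} X^a` (k monomials). -/
local notation3 "𝔸⟮" k "⟯" => (∑ a ∈ Finset.range k, (Polynomial.X : Polynomial ℂ) ^ (a + 1))
/-- `𝔹⟮k⟯ = ∑_{b<k} X^{kb}` (k monomials). -/
local notation3 "𝔹⟮" k "⟯" => (∑ b ∈ Finset.range k, (Polynomial.X : Polynomial ℂ) ^ (k * b))
/-- `ℭ⟮k, r⟯ = X^{k²+1} ∑_{j<r} X^j` (r monomials). -/
local notation3 "ℭ⟮" k ", " r "⟯" => (∑ j ∈ Finset.range r, (Polynomial.X : Polynomial ℂ) ^ (k * k + 1 + j))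
/-- `𝕌⟮p⟯ = ∑_{m<p} [m ≠ 0] X^m`, the all-ones target typed like the crux's `F_p`. -/
local notation3 "𝕌⟮" p "⟯" => (∑ m ∈ Finset.range p, Polynomial.C ((if m = 0 then (0 : ℤ) else 1 : ℤ) : ℂ) * (Polynomial.X : Polynomial ℂ) ^ m)
/-- `𝔉⟮p⟯ = F_p = ∑_{m<p} (m|p) X^m`, the crux's literal right-hand side. -/
local notation3 "𝔉⟮" p "⟯" => (∑ m ∈ Finset.range p, Polynomial.C ((legendreSym p m : ℤ) : ℂ) * (Polynomial.X : Polynomial ℂ) ^ m)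

/-! ## §0 Helpers -/

/-- Support card is subadditive over finite sums. [folklore] -/
theorem card_support_sum_le {ι : Type*} (s : Finset ι) (q : ι → ℂ[X]) :
    (∑ i ∈ s, q i).support.card ≤ ∑ i ∈ s, (q i).support.card := by
  classical
  induction s using Finset.induction_on with
  | empty => simp
  | @insert a s ha ih =>
    rw [Finset.sum_insert ha, Finset.sum_insert ha]
    exact (Finset.card_le_card Polynomial.support_add).trans
      ((Finset.card_union_le _ _).trans (Nat.add_le_add le_rfl ih))

/-- A sum of `#s` monomials has at most `#s` monomials. [folklore] -/
theorem card_support_sum_X_pow_le (s : Finset ℕ) (f : ℕ → ℕ) :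
    (∑ a ∈ s, (X : ℂ[X]) ^ f a).support.card ≤ s.card := by
  refine (card_support_sum_le s _).trans ?_
  calc ∑ a ∈ s, ((X : ℂ[X]) ^ f a).support.card ≤ ∑ a ∈ s, 1 :=
        Finset.sum_le_sum fun a _ => by rw [Polynomial.support_X_pow]; simp
    _ = s.card := by simp

/-- Block geometric series: `(∑_{i<m} x^i)(∑_{j<n} x^{mj}) = ∑_{l<mn} x^l`. [folklore] -/
theorem geom_block (x : ℂ[X]) (m n : ℕ) :
    (∑ i ∈ range m, x ^ i) * (∑ j ∈ range n, x ^ (m * j)) = ∑ l ∈ range (m * n), x ^ l := by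
  induction n with
  | zero => simp
  | succ n ih =>
    rw [Finset.sum_range_succ, mul_add, ih, Nat.mul_succ, Finset.sum_range_add, Finset.sum_mul]
    congr 1
    refine Finset.sum_congr rfl fun i _ => ?_
    rw [← pow_add, add_comm]

/-- natDegree of a sum of monomials `X^{f a}` with `f a ≤ N` is `≤ N`. [folklore] -/
theorem natDegree_sum_X_pow_le (s : Finset ℕ) (f : ℕ → ℕ) (N : ℕ) (h : ∀ a ∈ s, f a ≤ N) :
    (∑ a ∈ s, (X : ℂ[X]) ^ f a).natDegree ≤ N :=
  natDegree_sum_le_of_forall_le _ _ fun a ha => (natDegree_X_pow_le _).trans (h a ha)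

/-! ## §A `χ_p` is load-bearing: the all-ones target of the same length has support-sum `O(√p)` with 4 squares -/

/-- `A_k · B_k = X · ∑_{l<k²} X^l` (block geometric series). [folklore] -/
theorem blockA_mul_blockB (k : ℕ) : 𝔸⟮k⟯ * 𝔹⟮k⟯ = ∑ l ∈ range (k * k), (X : ℂ[X]) ^ (l + 1) := by
  have hA : 𝔸⟮k⟯ = X * ∑ a ∈ range k, (X : ℂ[X]) ^ a := by
    rw [Finset.mul_sum]
    exact Finset.sum_congr rfl fun a _ => by rw [pow_succ, mul_comm]
  rw [hA, mul_assoc, geom_block, Finset.mul_sum]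
  exact Finset.sum_congr rfl fun l _ => by rw [pow_succ, mul_comm]

/-- `U_p = ∑_{m<p-1} X^{m+1}` (drop the vanishing `m = 0` term). [folklore] -/
theorem allOnes_eq_sum (p : ℕ) (hp : 1 ≤ p) : 𝕌⟮p⟯ = ∑ m ∈ range (p - 1), (X : ℂ[X]) ^ (m + 1) := by
  obtain ⟨n, rfl⟩ : ∃ n, p = n + 1 := ⟨p - 1, by omega⟩
  rw [Finset.sum_range_succ']
  simp

/-- The digit identity `U_p = A_k B_k + C_{k,r}` whenever `k² ≤ p − 1` and `r = p − 1 − k²`. [folklore] -/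
theorem allOnes_eq_prod_add (p k r : ℕ) (hp : 1 ≤ p) (hkk : k * k ≤ p - 1) (hr : r = p - 1 - k * k) :
    𝕌⟮p⟯ = 𝔸⟮k⟯ * 𝔹⟮k⟯ + ℭ⟮k, r⟯ := by
  rw [allOnes_eq_sum p hp, blockA_mul_blockB]
  conv_lhs => rw [show p - 1 = k * k + r by omega]
  rw [Finset.sum_range_add]
  congr 1
  exact Finset.sum_congr rfl fun j _ => by congr 1; ring

/-- `A_k` has at most `k` monomials. [folklore] -/
theorem card_support_blockA (k : ℕ) : (𝔸⟮k⟯).support.card ≤ k := by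
  simpa using card_support_sum_X_pow_le (range k) (fun a => a + 1)
/-- `B_k` has at most `k` monomials. [folklore] -/
theorem card_support_blockB (k : ℕ) : (𝔹⟮k⟯).support.card ≤ k := by
  simpa using card_support_sum_X_pow_le (range k) (fun b => k * b)
/-- `C_{k,r}` has at most `r` monomials. [folklore] -/
theorem card_support_blockC (k r : ℕ) : (ℭ⟮k, r⟯).support.card ≤ r := by
  simpa using card_support_sum_X_pow_le (range r) (fun j => k * k + 1 + j)

/-- `deg A_k ≤ k`. [folklore] -/
theorem natDegree_blockA (k : ℕ) : (𝔸⟮k⟯).natDegree ≤ k := by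
  exact natDegree_sum_X_pow_le (range k) (fun a => a + 1) k fun a ha => by simp at ha; omega
/-- `deg B_k ≤ k²`. [folklore] -/
theorem natDegree_blockB (k : ℕ) : (𝔹⟮k⟯).natDegree ≤ k * k := by
  exact natDegree_sum_X_pow_le (range k) (fun b => k * b) (k * k) fun b hb => by
    simp at hb; exact Nat.mul_le_mul_left k (by omega)
/-- `deg C_{k,r} ≤ k² + r`. [folklore] -/
theorem natDegree_blockC (k r : ℕ) : (ℭ⟮k, r⟯).natDegree ≤ k * k + r := by
  exact natDegree_sum_X_pow_le (range r) (fun j => k * k + 1 + j) (k * k + r) fun j hj => by simp at hj; omega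

/-- `C ¼ · 4 = 1` in `ℂ[X]`. [folklore] -/
theorem C_inv_four_mul_four : (C (4⁻¹ : ℂ)) * 4 = (1 : ℂ[X]) := by
  rw [← Polynomial.C_ofNat 4, ← map_mul, inv_mul_cancel₀ (by norm_num : (4 : ℂ) ≠ 0), map_one]

/-- `1` has at most one monomial. [folklore] -/
theorem card_support_one_le : (1 : ℂ[X]).support.card ≤ 1 := by
  simpa using (card_support_C_mul_X_pow_le_one (R := ℂ) (c := 1) (n := 0))

/-- Support card is subadditive. [folklore] -/
theorem card_support_add_le' (P Q : ℂ[X]) : (P + Q).support.card ≤ P.support.card + Q.support.card :=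
  (Finset.card_le_card support_add).trans (Finset.card_union_le _ _)

/-- Support card is subadditive (difference). [folklore] -/
theorem card_support_sub_le' (P Q : ℂ[X]) : (P - Q).support.card ≤ P.support.card + Q.support.card := by
  rw [sub_eq_add_neg]
  simpa [support_neg] using card_support_add_le' P (-Q)

/-- **`χ_p` is load-bearing.**  `FeketeBoundedFaninWithoutLegendre` is false: at `s₀ = 4`, for every `δ > 0` and
every `p₀`, some prime `p ≥ p₀` carries the representation `U_p = ¼(A+B)² − ¼(A−B)² + ¼(C+1)² − ¼(C−1)²` of
support-sum `≤ 8⌊√(p−1)⌋ + 2 < p^{1/2+δ}`.  Any proof of `FeketeBoundedFanin` must use the Legendre signs. [folklore] -/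
theorem feketeBoundedFanin_false_without_legendre :
    ¬ (∀ s₀ : ℕ, ∃ δ : ℝ, 0 < δ ∧ ∃ p₀ : ℕ, ∀ (p : ℕ) [Fact p.Prime], p₀ ≤ p → ∀ (c : Fin s₀ → ℂ) (g : Fin s₀ → Polynomial ℂ), (∀ i, (g i).natDegree ≤ p ^ 2) → (∑ i, Polynomial.C (c i) * g i ^ 2) = ∑ m ∈ Finset.range p, Polynomial.C ((if m = 0 then (0 : ℤ) else 1 : ℤ) : ℂ) * Polynomial.X ^ m → (p : ℝ) ^ (1 / 2 + δ) ≤ ∑ i, ((g i).support.card : ℝ)) := by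
  intro H
  obtain ⟨δ, hδ, p₀, H⟩ := H 4
  -- choose a prime p ≥ p₀ with p^δ ≥ 11
  set M : ℝ := (11 : ℝ) ^ δ⁻¹ with hM
  have hM0 : 0 ≤ M := Real.rpow_nonneg (by norm_num) _
  obtain ⟨p, hp_ge, hp⟩ := Nat.exists_infinite_primes (max p₀ (⌈M⌉₊ + 2))
  haveI : Fact p.Prime := ⟨hp⟩
  have hp0 : p₀ ≤ p := le_of_max_le_left hp_ge
  have hpc : ⌈M⌉₊ + 2 ≤ p := le_of_max_le_right hp_ge
  have hp2 : 2 ≤ p := hp.two_le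
  have hp1 : 1 ≤ p := by omega
  have hpM : M ≤ (p : ℝ) := by
    have h1 : ((⌈M⌉₊ : ℕ) : ℝ) ≤ (p : ℝ) := by exact_mod_cast (by omega : ⌈M⌉₊ ≤ p)
    exact (Nat.le_ceil M).trans h1
  -- the witness
  set k := Nat.sqrt (p - 1) with hk
  set r := p - 1 - k * k with hr
  have hkk : k * k ≤ p - 1 := Nat.sqrt_le (p - 1)
  have hr2 : r ≤ 2 * k := by
    have := Nat.sqrt_le_add (p - 1)
    rw [← hk] at this
    omega
  have hk1 : k ≤ p - 1 := by rw [hk]; exact Nat.sqrt_le_self (p - 1)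
  have hp22 : p - 1 ≤ p ^ 2 := (Nat.sub_le p 1).trans (Nat.le_self_pow two_ne_zero p)
  have hdA : (𝔸⟮k⟯).natDegree ≤ k := natDegree_blockA k
  have hdB : (𝔹⟮k⟯).natDegree ≤ k * k := natDegree_blockB k
  have hdC : (ℭ⟮k, r⟯).natDegree ≤ k * k + r := natDegree_blockC k r
  have h1 : (𝔸⟮k⟯ + 𝔹⟮k⟯).natDegree ≤ p ^ 2 :=
    (natDegree_add_le _ _).trans (max_le (by omega) (by omega))
  have h2 : (𝔸⟮k⟯ - 𝔹⟮k⟯).natDegree ≤ p ^ 2 :=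
    (natDegree_sub_le _ _).trans (max_le (by omega) (by omega))
  have h3 : (ℭ⟮k, r⟯ + 1).natDegree ≤ p ^ 2 :=
    (natDegree_add_le _ _).trans (max_le (by omega) (by simp))
  have h4 : (ℭ⟮k, r⟯ - 1).natDegree ≤ p ^ 2 :=
    (natDegree_sub_le _ _).trans (max_le (by omega) (by simp))
  have hdeg : ∀ i, ((![𝔸⟮k⟯ + 𝔹⟮k⟯, 𝔸⟮k⟯ - 𝔹⟮k⟯, ℭ⟮k, r⟯ + 1, ℭ⟮k, r⟯ - 1] :
      Fin 4 → ℂ[X]) i).natDegree ≤ p ^ 2 := by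
    intro i
    fin_cases i
    exacts [h1, h2, h3, h4]
  have hident : (∑ i, Polynomial.C ((![4⁻¹, -4⁻¹, 4⁻¹, -4⁻¹] : Fin 4 → ℂ) i) *
      (![𝔸⟮k⟯ + 𝔹⟮k⟯, 𝔸⟮k⟯ - 𝔹⟮k⟯, ℭ⟮k, r⟯ + 1, ℭ⟮k, r⟯ - 1] : Fin 4 → ℂ[X]) i ^ 2)
        = 𝕌⟮p⟯ := by
    rw [allOnes_eq_prod_add p k r hp1 hkk hr]
    simp only [Fin.sum_univ_four, Matrix.cons_val, map_neg]
    linear_combination (𝔸⟮k⟯ * 𝔹⟮k⟯ + ℭ⟮k, r⟯) * C_inv_four_mul_four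
  have hbound := H p hp0 _ _ hdeg hident
  -- support-sum ≤ 8k + 2
  have hsA := card_support_blockA k
  have hsB := card_support_blockB k
  have hsC := card_support_blockC k r
  have hs1 : (𝔸⟮k⟯ + 𝔹⟮k⟯).support.card ≤ k + k := (card_support_add_le' _ _).trans (by omega)
  have hs2 : (𝔸⟮k⟯ - 𝔹⟮k⟯).support.card ≤ k + k := (card_support_sub_le' _ _).trans (by omega)
  have hs3 : (ℭ⟮k, r⟯ + 1).support.card ≤ r + 1 :=
    (card_support_add_le' _ _).trans (Nat.add_le_add hsC card_support_one_le)
  have hs4 : (ℭ⟮k, r⟯ - 1).support.card ≤ r + 1 :=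
    (card_support_sub_le' _ _).trans (Nat.add_le_add hsC card_support_one_le)
  have hS : (∑ i, (((![𝔸⟮k⟯ + 𝔹⟮k⟯, 𝔸⟮k⟯ - 𝔹⟮k⟯, ℭ⟮k, r⟯ + 1, ℭ⟮k, r⟯ - 1] :
      Fin 4 → ℂ[X]) i).support.card : ℝ)) ≤ 8 * (k : ℝ) + 2 := by
    simp only [Fin.sum_univ_four, Matrix.cons_val]
    have e1 : ((𝔸⟮k⟯ + 𝔹⟮k⟯).support.card : ℝ) ≤ k + k := by exact_mod_cast hs1
    have e2 : ((𝔸⟮k⟯ - 𝔹⟮k⟯).support.card : ℝ) ≤ k + k := by exact_mod_cast hs2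
    have e3 : ((ℭ⟮k, r⟯ + 1).support.card : ℝ) ≤ r + 1 := by exact_mod_cast hs3
    have e4 : ((ℭ⟮k, r⟯ - 1).support.card : ℝ) ≤ r + 1 := by exact_mod_cast hs4
    have e5 : (r : ℝ) ≤ 2 * k := by exact_mod_cast hr2
    linarith
  -- 8k + 2 < 11 √p ≤ p^{1/2+δ}
  have hp_pos : (0 : ℝ) < p := by exact_mod_cast (by omega : 0 < p)
  have hk_sqrt : (k : ℝ) ≤ Real.sqrt p := by
    refine Real.le_sqrt_of_sq_le ?_
    have : ((k * k : ℕ) : ℝ) ≤ (p : ℝ) := by exact_mod_cast (hkk.trans (Nat.sub_le p 1))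
    push_cast at this
    nlinarith
  have h1_sqrt : (1 : ℝ) ≤ Real.sqrt p :=
    Real.le_sqrt_of_sq_le (by rw [one_pow]; exact_mod_cast hp1)
  have hpd : (11 : ℝ) ≤ (p : ℝ) ^ δ := by
    have := Real.rpow_le_rpow hM0 hpM hδ.le
    rwa [hM, Real.rpow_inv_rpow (by norm_num) hδ.ne'] at this
  have hsplit : (p : ℝ) ^ (1 / 2 + δ) = Real.sqrt p * (p : ℝ) ^ δ := by
    rw [Real.rpow_add hp_pos, Real.sqrt_eq_rpow]
  have h11 : Real.sqrt p * 11 ≤ Real.sqrt p * (p : ℝ) ^ δ :=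
    mul_le_mul_of_nonneg_left hpd (Real.sqrt_nonneg _)
  rw [hsplit] at hbound
  linarith

/-! ## §A2 PRIMALITY is load-bearing: the Jacobi analogue fails at `s₀ = 2` for prime squares `n = q²` -/

/-- Jacobi symbol modulo `q²` (`q` prime): `J(qb + a | q·q) = [a ≠ 0]` for `a < q`. [folklore] -/
theorem jacobiSym_sq_block (q : ℕ) [Fact q.Prime] (b a : ℕ) (ha : a < q) :
    jacobiSym ((q * b + a : ℕ) : ℤ) (q * q) = if a = 0 then 0 else 1 := by
  have hq0 : q ≠ 0 := (Fact.out : q.Prime).ne_zero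
  rw [jacobiSym.mul_right' _ hq0 hq0, ← jacobiSym.legendreSym.to_jacobiSym]
  have hcast : (((q * b + a : ℕ) : ℤ) : ZMod q) = ((a : ℕ) : ZMod q) := by
    push_cast
    simp
  by_cases ha0 : a = 0
  · subst ha0
    have h0 : legendreSym q ((q * b + 0 : ℕ) : ℤ) = 0 := by
      rw [legendreSym.eq_zero_iff, hcast]; simp
    rw [h0]; simp
  · have hne : (((q * b + a : ℕ) : ℤ) : ZMod q) ≠ 0 := by
      rw [hcast, Ne, ZMod.natCast_eq_zero_iff]
      intro hdvd
      exact ha0 (Nat.eq_zero_of_dvd_of_lt hdvd ha)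
    rw [if_neg ha0, ← sq, legendreSym.sq_one (p := q) hne]

/-- The digit identity for the Jacobi–Fekete polynomial of a prime square:
`∑_{m<qN} J(m | q²) X^m = (∑_{1≤a<q} X^a) · ∑_{b<N} X^{qb}`. [folklore] -/
theorem jacobi_sq_sum_eq (q : ℕ) [Fact q.Prime] (N : ℕ) :
    ∑ m ∈ range (q * N), C ((jacobiSym (m : ℤ) (q * q) : ℤ) : ℂ) * (X : ℂ[X]) ^ m =
      (∑ a ∈ range (q - 1), (X : ℂ[X]) ^ (a + 1)) * ∑ b ∈ range N, (X : ℂ[X]) ^ (q * b) := by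
  have hq1 : 1 ≤ q := (Fact.out : q.Prime).one_lt.le
  obtain ⟨Q, hQ⟩ : ∃ Q, q = Q + 1 := ⟨q - 1, by omega⟩
  have hQ' : q - 1 = Q := by omega
  rw [hQ']
  induction N with
  | zero => simp
  | succ N ih =>
    rw [Nat.mul_succ, Finset.sum_range_add, ih, Finset.sum_range_succ, mul_add]
    congr 1
    have h0 : jacobiSym ((q * N + 0 : ℕ) : ℤ) (q * q) = 0 := by
      rw [jacobiSym_sq_block q N 0 (by omega)]; simp
    have h1 : ∀ a, a < Q → jacobiSym ((q * N + (a + 1) : ℕ) : ℤ) (q * q) = 1 := fun a haQ => by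
      rw [jacobiSym_sq_block q N (a + 1) (by omega)]; simp
    have hsplit : ∑ a ∈ range q, C ((jacobiSym ((q * N + a : ℕ) : ℤ) (q * q) : ℤ) : ℂ) * (X : ℂ[X]) ^ (q * N + a)
        = ∑ a ∈ range Q, C ((jacobiSym ((q * N + (a + 1) : ℕ) : ℤ) (q * q) : ℤ) : ℂ) * (X : ℂ[X]) ^ (q * N + (a + 1))
          + C ((jacobiSym ((q * N + 0 : ℕ) : ℤ) (q * q) : ℤ) : ℂ) * (X : ℂ[X]) ^ (q * N + 0) := by
      subst hQ
      exact Finset.sum_range_succ' _ _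
    rw [hsplit, h0, Finset.sum_mul]
    simp only [Int.cast_zero, map_zero, zero_mul, add_zero]
    refine Finset.sum_congr rfl fun a haQ => ?_
    rw [Finset.mem_range] at haQ
    rw [h1 a haQ]
    simp only [Int.cast_one, map_one, one_mul, ← pow_add]
    congr 1; ring


/-- **Primality is load-bearing.**  `FeketeBoundedFaninJacobi` is false already at `s₀ = 2`: for a prime `q` the
Jacobi–Fekete polynomial of `n = q²` is ONE sparse product, `∑_{m<q²} J(m|q²) X^m = (∑_{1≤a<q} X^a)(∑_{b<q} X^{qb})`
(`J(m|q²) = [q ∤ m]`), i.e. `¼(A+B)² − ¼(A−B)²` with support-sum `≤ 4q − 2 < 5q ≤ n^{1/2+δ}` once `q^{2δ} ≥ 5`.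
So any proof of `FeketeBoundedFanin` must use that `p` is prime (at least squarefree) beyond the typing of
`legendreSym`: periodicity of `χ` modulo a proper divisor is exactly the digit structure that makes squares cheap.
[folklore] -/
theorem feketeBoundedFanin_false_with_jacobi :
    ¬ (∀ s₀ : ℕ, ∃ δ : ℝ, 0 < δ ∧ ∃ p₀ : ℕ, ∀ (p : ℕ), Odd p → p₀ ≤ p → ∀ (c : Fin s₀ → ℂ) (g : Fin s₀ → Polynomial ℂ), (∀ i, (g i).natDegree ≤ p ^ 2) → (∑ i, Polynomial.C (c i) * g i ^ 2) = ∑ m ∈ Finset.range p, Polynomial.C ((jacobiSym m p : ℤ) : ℂ) * Polynomial.X ^ m → (p : ℝ) ^ (1 / 2 + δ) ≤ ∑ i, ((g i).support.card : ℝ)) := by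
  intro H
  obtain ⟨δ, hδ, p₀, H⟩ := H 2
  have h2δ : (2 * δ) ≠ 0 := by positivity
  set M : ℝ := (5 : ℝ) ^ (2 * δ)⁻¹ with hM
  have hM0 : 0 ≤ M := Real.rpow_nonneg (by norm_num) _
  obtain ⟨q, hq_ge, hq⟩ := Nat.exists_infinite_primes (max p₀ (⌈M⌉₊ + 3))
  haveI : Fact q.Prime := ⟨hq⟩
  have hq0 : p₀ ≤ q := le_of_max_le_left hq_ge
  have hqc : ⌈M⌉₊ + 3 ≤ q := le_of_max_le_right hq_ge
  have hq3 : 3 ≤ q := by omega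
  have hqodd : Odd q := hq.odd_of_ne_two (by omega)
  have hnodd : Odd (q * q) := hqodd.mul hqodd
  have hn0 : p₀ ≤ q * q := hq0.trans (Nat.le_mul_self q)
  have hqM : M ≤ (q : ℝ) := (Nat.le_ceil M).trans (by exact_mod_cast (by omega : ⌈M⌉₊ ≤ q))
  -- the witness: A = blockA (q-1), B = 𝔹⟮q⟯, target = A * B
  have hAB : ∑ m ∈ Finset.range (q * q), Polynomial.C ((jacobiSym m (q * q) : ℤ) : ℂ) * Polynomial.X ^ m
      = 𝔸⟮q - 1⟯ * 𝔹⟮q⟯ := by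
    rw [jacobi_sq_sum_eq q q]
  have hdA : (𝔸⟮q - 1⟯).natDegree ≤ q - 1 := natDegree_blockA (q - 1)
  have hdB : (𝔹⟮q⟯).natDegree ≤ q * q := natDegree_blockB q
  have hqq' : q * q ≤ (q * q) ^ 2 := by rw [pow_two]; exact Nat.le_mul_self (q * q)
  have hqq : q - 1 ≤ (q * q) ^ 2 := ((Nat.sub_le q 1).trans (Nat.le_mul_self q)).trans hqq'
  have h1 : (𝔸⟮q - 1⟯ + 𝔹⟮q⟯).natDegree ≤ (q * q) ^ 2 :=
    (natDegree_add_le _ _).trans (max_le (by omega) (by omega))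
  have h2 : (𝔸⟮q - 1⟯ - 𝔹⟮q⟯).natDegree ≤ (q * q) ^ 2 :=
    (natDegree_sub_le _ _).trans (max_le (by omega) (by omega))
  have hdeg : ∀ i, ((![𝔸⟮q - 1⟯ + 𝔹⟮q⟯, 𝔸⟮q - 1⟯ - 𝔹⟮q⟯] : Fin 2 → ℂ[X]) i).natDegree
      ≤ (q * q) ^ 2 := by
    intro i
    fin_cases i
    exacts [h1, h2]
  have hident : (∑ i, Polynomial.C ((![4⁻¹, -4⁻¹] : Fin 2 → ℂ) i) *
      (![𝔸⟮q - 1⟯ + 𝔹⟮q⟯, 𝔸⟮q - 1⟯ - 𝔹⟮q⟯] : Fin 2 → ℂ[X]) i ^ 2)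
        = ∑ m ∈ Finset.range (q * q), Polynomial.C ((jacobiSym m (q * q) : ℤ) : ℂ) * Polynomial.X ^ m := by
    rw [hAB]
    simp only [Fin.sum_univ_two, Matrix.cons_val_zero, Matrix.cons_val_one, map_neg]
    linear_combination (𝔸⟮q - 1⟯ * 𝔹⟮q⟯) * C_inv_four_mul_four
  have hbound := H (q * q) hnodd hn0 _ _ hdeg hident
  -- support-sum ≤ 4q − 2
  have hsA := card_support_blockA (q - 1)
  have hsB := card_support_blockB q
  have hs1 : (𝔸⟮q - 1⟯ + 𝔹⟮q⟯).support.card ≤ (q - 1) + q := (card_support_add_le' _ _).trans (by omega)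
  have hs2 : (𝔸⟮q - 1⟯ - 𝔹⟮q⟯).support.card ≤ (q - 1) + q := (card_support_sub_le' _ _).trans (by omega)
  have hS : (∑ i, (((![𝔸⟮q - 1⟯ + 𝔹⟮q⟯, 𝔸⟮q - 1⟯ - 𝔹⟮q⟯] : Fin 2 → ℂ[X]) i).support.card : ℝ))
      ≤ 4 * (q : ℝ) - 2 := by
    simp only [Fin.sum_univ_two, Matrix.cons_val_zero, Matrix.cons_val_one]
    have hq1 : 1 ≤ q := by omega
    have e1 : ((𝔸⟮q - 1⟯ + 𝔹⟮q⟯).support.card : ℝ) ≤ 2 * (q : ℝ) - 1 := by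
      have : (((𝔸⟮q - 1⟯ + 𝔹⟮q⟯).support.card : ℕ) : ℝ) ≤ ((q - 1 + q : ℕ) : ℝ) := by exact_mod_cast hs1
      rw [Nat.cast_add, Nat.cast_sub hq1] at this; push_cast at this; linarith
    have e2 : ((𝔸⟮q - 1⟯ - 𝔹⟮q⟯).support.card : ℝ) ≤ 2 * (q : ℝ) - 1 := by
      have : (((𝔸⟮q - 1⟯ - 𝔹⟮q⟯).support.card : ℕ) : ℝ) ≤ ((q - 1 + q : ℕ) : ℝ) := by exact_mod_cast hs2
      rw [Nat.cast_add, Nat.cast_sub hq1] at this; push_cast at this; linarith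
    linarith
  -- 4q − 2 < 5q ≤ q · q^{2δ} = (q²)^{1/2+δ}
  have hq_pos : (0 : ℝ) < q := by exact_mod_cast (by omega : 0 < q)
  have hqd : (5 : ℝ) ≤ (q : ℝ) ^ (2 * δ) := by
    have := Real.rpow_le_rpow hM0 hqM (by positivity : 0 ≤ 2 * δ)
    rwa [hM, Real.rpow_inv_rpow (by norm_num) h2δ] at this
  have hsplit : ((q * q : ℕ) : ℝ) ^ (1 / 2 + δ) = (q : ℝ) * (q : ℝ) ^ (2 * δ) := by
    have e : ((q * q : ℕ) : ℝ) = (q : ℝ) ^ (2 : ℕ) := by push_cast; ring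
    rw [e, ← Real.rpow_natCast_mul hq_pos.le 2 (1 / 2 + δ)]
    rw [show ((2 : ℕ) : ℝ) * (1 / 2 + δ) = 1 + 2 * δ by push_cast; ring]
    rw [Real.rpow_add hq_pos, Real.rpow_one]
  have h5 : (q : ℝ) * 5 ≤ (q : ℝ) * (q : ℝ) ^ (2 * δ) := mul_le_mul_of_nonneg_left hqd hq_pos.le
  rw [hsplit] at hbound
  linarith

end

end Summit.ValiantsHypothesis.ValiantsHypothesis.Theorems.FeketeBoundedFanin.Negative
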